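import Summits.BirchSwinnertonDyer.BirchSwinnertonDyer.Theorems.Rank1ResidualJetCarrierMultEndForm
import Literature.NumberTheory.EllipticCurves.TamagawaSubgroupProofs
import HarnessLib

/-!
# The walk's CARRIER at `p`: from the stub's place `v` of `ℚ` with `p ∣ c_v(E)` to a split place `v₀`
# of `K` over it, with the stringent family's (δ) data read off `c_v(E)` (cell `bsd-stepL`, seat
# `bsd-stepL-tam3-p1`, helper toward item 19109 `EulerHalvesAtThree`, registered stub `stub_supplyAtThree`)

HONEST FRAMING. Nothing here proves BSD, J₃ or any divisibility of a Heegner point; no stub is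
discharged; no item closes; 0 classes move (T7); `--supports stmt-BirchSwinnertonDyer-19109` (helper).

WHAT THIS FILE DOES. The supply stub quantifies over a place `v` of `ℚ` and asks, in its conjunct
`hdual_q`, for a carrier module of order `p ^ ord_p c_v(E)` (`W.tamagawaNumberAt v`). bsd-jet's road-K
bricks produce the carrier data at a place `v₀` of `K`: `exists_split_place_of_dvd` (a place over a
prime `q ∣ N` moved by `τ`), `carrierRowData_of_split` (p516218: the row data over `K_{v₀}` are the
`ℚ_q`-data), `relIndex_stringentFamily_eq_pow` ∕ `isAddCyclic_kummer_quotient_stringentFamily` ((δ)).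
This file joins them to the stub's currency:
* `exists_prime_under_of_padicValNat_pos` — if `p ∣ c_v(E)` then the prime `q` under `v` divides the
  conductor (`c_v = 1` at good places, `localTamagawaNumber_eq_one_of_hasGoodReductionAt_holds`;
  `dvd_conductorNorm_iff`), and `c_q(W⁄ℚ_q) = c_v` (`localTamagawaNumber_padic_eq_holds`);
* `exists_stringentCarrier` — for `K` imaginary quadratic Heegner for `N`, `τ ≠ 1`, and the END-FORM
  Kodaira–Néron datum `hΦ` (component group cyclic when `p ∣ c_q`, `p` odd): a place `v₀` with
  `τ • v₀ ≠ v₀`, `N ∈ v₀`, `N ∈ τ • v₀`, the stringent family `𝒮 = JET.stringentFamily` `τ`-stable, and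
  (δ): `Kum_{v₀}/𝒮_{v₀}` cyclic of order `p ^ ord_p c_v(E)` — exactly the inputs `hS`, `v₀`, `hv₀`,
  `hv₀N`, `h𝒮σ`, `hcyc`, `hidx` of `Walk.exists_dualityConjuncts_of_rowDuality` (p516936) with
  `t := padicValNat p (W.tamagawaNumberAt v)`;
* `exists_kummerCarrier` — the degenerate carrier for `ord_p c_v(E) = 0`: any prime `q ∣ N` (there is
  one: `E` is multiplicative at `p`), `𝒮 :=` the Kummer family itself, index `p ^ 0`.
References (locators only; no cited FACT is declared): [cite: Jetchev2008, Lemma 3.2 (p. 814), (δ)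
(p. 822), Thm. 5.2] [cite: SilvermanAEC2009, VII.6 Thm. 6.1, X.§4] [cite: CasselsFrohlichANT1967,
Ch. VII Prop. 1.2 (ii)] [cite: DiamondShurman2005, §8.3]. Design: no definitions; `K : Type`. Axioms:
`propext`, `Classical.choice`, `Quot.sound`.
-/

set_option autoImplicit false

noncomputable section

open scoped Classical Pointwise
open Function NumberField IsDedekindDomain WeierstrassCurve Field
open Literature.NumberTheory.EllipticCurves Literature.NumberTheory.GaloisRepresentations
open Literature.NumberTheory.EllipticCurves.Jetchev2008
open Literature.NumberTheory.GaloisCohomology Literature.NumberTheory.Automorphic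
open Summit.BirchSwinnertonDyer.Rank1Residual.JET.SelmerVocabulary

namespace Summit.BirchSwinnertonDyer.Rank1Residual.JET.Walk

variable (W : WeierstrassCurve ℚ) [W.IsElliptic] [W.IsGloballyMinimal]

omit [W.IsGloballyMinimal] in
/-- **The prime under a place of `ℚ` where `p ∣ c_v(E)` divides the conductor, and `c_q(W⁄ℚ_q) = c_v`.**
(`c_v = 1` at a place of good reduction, so `v` is bad; `q ∣ N_E` iff bad.)
[cite: SilvermanAEC2009, VII.6 Thm. 6.1] [cite: DiamondShurman2005, §8.3] -/
theorem exists_prime_under_of_padicValNat_pos (p : ℕ) (v : HeightOneSpectrum (𝓞 ℚ))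
    (ht : 1 ≤ padicValNat p (W.tamagawaNumberAt v)) :
    ∃ q : ℕ, ∃ _ : Fact q.Prime, ((q : ℕ) : 𝓞 ℚ) ∈ v.asIdeal ∧ q ∣ W.conductorNorm ℤ ∧
      (W.baseChange ℚ_[q]).localTamagawaNumber ℤ_[q] = W.tamagawaNumberAt v := by
  -- the rational prime in `v`
  have hN : ((Ideal.absNorm v.asIdeal : ℕ) : 𝓞 ℚ) ∈ v.asIdeal := Ideal.absNorm_mem _
  have hN0 : Ideal.absNorm v.asIdeal ≠ 0 := fun h ↦ v.ne_bot (Ideal.absNorm_eq_zero_iff.mp h)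
  obtain ⟨q, hq, hqv⟩ := (natCast_mem_iff_exists_primeFactor_mem hN0 v).mp hN
  have hqp : q.Prime := Nat.prime_of_mem_primeFactors hq
  haveI : Fact q.Prime := ⟨hqp⟩
  have hqq : ((Rat.HeightOneSpectrum.primesEquiv v : Nat.Primes) : ℕ) = q :=
    LocalField.primesEquiv_eq_of_natCast_mem q v hqv
  -- `v` is a bad place: `c_v ≠ 1`
  have hbad : ¬ W.HasGoodReductionAt v := by
    intro hgood
    have h1 : W.tamagawaNumberAt v = 1 :=
      WeierstrassCurve.localTamagawaNumber_eq_one_of_hasGoodReductionAt_holds W v hgood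
    rw [h1, padicValNat_one_right] at ht
    exact absurd ht (by norm_num)
  have hqN : q ∣ W.conductorNorm ℤ := by
    rw [← hqq]; exact (W.dvd_conductorNorm_iff v).mpr hbad
  exact ⟨q, ⟨hqp⟩, hqv, hqN, WeierstrassCurve.localTamagawaNumber_padic_eq_holds W v q hqq⟩

variable (K : Type) [Field K] [NumberField K]

/-- **The stringent carrier.** For `K` imaginary quadratic with the Heegner hypothesis for `N = N_E`,
`τ ≠ 1` in `Aut(K/ℚ)`, a place `v` of `ℚ` with `p ∣ c_v(E)` (`p` odd), a level `p^k` and the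
Kodaira–Néron datum `hΦ` (END-FORM shape of bsd-jet's road K): a place `v₀` of `K` moved by `τ` with
`N ∈ v₀`, `N ∈ τ • v₀`, and for `𝒮 := JET.stringentFamily W K hn`: `𝒮 ≤ Kum` everywhere, `𝒮` is
`τ`-stable, and (δ) `Kum_{v₀}/𝒮_{v₀}` is cyclic of order `p ^ ord_p c_v(E)`.
[cite: Jetchev2008, Lemma 3.2 (p. 814), (δ) (p. 822)] [cite: CasselsFrohlichANT1967, Ch. VII Prop. 1.2 (ii)]
[cite: SilvermanAEC2009, X.§4] -/
theorem exists_stringentCarrier (hK : IsImaginaryQuadratic K) (τ : K ≃ₐ[ℚ] K) (hτ : τ ≠ 1)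
    (hH : SatisfiesHeegnerHypothesis (W.conductorNorm ℤ) K) (p : ℕ) [Fact p.Prime] (hp2 : p ≠ 2)
    (hΦ : ∀ (W : WeierstrassCurve ℚ) [W.IsElliptic] [W.IsGloballyMinimal] (ℓ p : ℕ) [Fact ℓ.Prime]
      [Fact p.Prime], p ≠ 2 → p ∣ (W.baseChange ℚ_[ℓ]).localTamagawaNumber ℤ_[ℓ] →
      ∀ [(W.baseChange ℚ_[ℓ]).IsMinimal ℤ_[ℓ]],
      IsAddCyclic ((W.baseChange ℚ_[ℓ]).toAffine.Point ⧸ (W.baseChange ℚ_[ℓ]).goodReductionSubgroup ℤ_[ℓ]))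
    (v : HeightOneSpectrum (𝓞 ℚ)) (ht : 1 ≤ padicValNat p (W.tamagawaNumberAt v))
    (k : ℕ) (hn : ((p ^ k : ℕ) : ℤ) ≠ 0) (htk : padicValNat p (W.tamagawaNumberAt v) ≤ k) :
    ∃ v₀ : HeightOneSpectrum (𝓞 K), τ • v₀ ≠ v₀ ∧
      ((W.conductorNorm ℤ : ℕ) : 𝓞 K) ∈ v₀.asIdeal ∧ ((W.conductorNorm ℤ : ℕ) : 𝓞 K) ∈ (τ • v₀).asIdeal ∧
      (∀ w, stringentFamily W K hn w ≤ (W.baseChange K).kummerSelmerStructure ((p ^ k : ℕ) : ℤ) w) ∧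
      (∀ (v w : HeightOneSpectrum (𝓞 K)) (h : τ • v = w), v ∈ ({v₀, τ • v₀} : Finset _) →
        ∀ x : galoisCohomology (((W.baseChange K).torsionGaloisModule ((p ^ k : ℕ) : ℤ)).toLocal
          (Sum.inr v : Place K)) 1,
        x ∈ stringentFamily W K hn (Sum.inr v) →
          conjActPlace W τ ((p ^ k : ℕ) : ℤ) h x ∈ stringentFamily W K hn (Sum.inr w)) ∧
      IsAddCyclic (↥((W.baseChange K).kummerSelmerStructure ((p ^ k : ℕ) : ℤ) (Sum.inr v₀)) ⧸
        (stringentFamily W K hn (Sum.inr v₀)).addSubgroupOf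
          ((W.baseChange K).kummerSelmerStructure ((p ^ k : ℕ) : ℤ) (Sum.inr v₀))) ∧
      (stringentFamily W K hn (Sum.inr v₀)).relIndex
          ((W.baseChange K).kummerSelmerStructure ((p ^ k : ℕ) : ℤ) (Sum.inr v₀)) =
        p ^ padicValNat p (W.tamagawaNumberAt v) := by
  have hp : p.Prime := Fact.out
  obtain ⟨q, hqF, -, hqN, hcq⟩ := exists_prime_under_of_padicValNat_pos W p v ht
  haveI := hqF
  -- the split place over `q`
  obtain ⟨v₀, hv₀, hv₀N, hqv₀⟩ := exists_split_place_of_dvd K hK τ hτ hH q hqN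
  have hv₀N' : ((W.conductorNorm ℤ : ℕ) : 𝓞 K) ∈ (τ • v₀).asIdeal := by
    have := (HeightOneSpectrum.smul_mem_smul_asIdeal_iff τ v₀ ((W.conductorNorm ℤ : ℕ) : 𝓞 K)).mpr hv₀N
    rwa [GlobalDuality.smul_natCast_ringOfIntegers] at this
  -- the row data over `K_{v₀}` are the `ℚ_q`-data
  obtain ⟨hminK, hminP, hcEq, hc0, hcyc⟩ := carrierRowData_of_split W K q hK τ v₀ hv₀ hqv₀
  haveI := hminK
  haveI := hminP
  have hpc : p ∣ (W.baseChange ℚ_[q]).localTamagawaNumber ℤ_[q] := by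
    rw [hcq]; exact dvd_of_one_le_padicValNat ht
  haveI := hcyc (hΦ W q p hp2 hpc)
  have hfac : (((W.baseChange K).baseChange (v₀.adicCompletion K)).localTamagawaNumber
      (v₀.adicCompletionIntegers K)).factorization p = padicValNat p (W.tamagawaNumberAt v) := by
    rw [hcEq, hcq, Nat.factorization_def _ hp]
  refine ⟨v₀, hv₀, hv₀N, hv₀N', fun w ↦ stringentFamily_le_kummer W K hn w,
    fun v' w h _ x hx ↦ conjActPlace_mem_stringentFamily W τ hn h hx,
    isAddCyclic_kummer_quotient_stringentFamily W K hn v₀, ?_⟩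
  rw [← hfac]
  exact relIndex_stringentFamily_eq_pow W K hp k hn v₀ hc0 (by rw [hfac]; exact htk)

omit [W.IsElliptic] [W.IsGloballyMinimal] in
/-- **The degenerate (Kummer) carrier** for `ord_p c_v(E) = 0`: a place `v₀` over any prime `q ∣ N`
moved by `τ` with `N ∈ v₀`, `N ∈ τ • v₀`, and for `𝒮 :=` the Kummer family: `τ`-stability, trivial
quotient `Kum_{v₀}/Kum_{v₀}` (cyclic, index `p ^ 0`). [cite: CasselsFrohlichANT1967, Ch. VII Prop. 1.2 (ii)]
[cite: SilvermanAEC2009, X.§4] -/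
theorem exists_kummerCarrier (hK : IsImaginaryQuadratic K) (τ : K ≃ₐ[ℚ] K) (hτ : τ ≠ 1)
    (hH : SatisfiesHeegnerHypothesis (W.conductorNorm ℤ) K) (q : ℕ) [Fact q.Prime]
    (hqN : q ∣ W.conductorNorm ℤ) (p k : ℕ) :
    ∃ v₀ : HeightOneSpectrum (𝓞 K), τ • v₀ ≠ v₀ ∧
      ((W.conductorNorm ℤ : ℕ) : 𝓞 K) ∈ v₀.asIdeal ∧ ((W.conductorNorm ℤ : ℕ) : 𝓞 K) ∈ (τ • v₀).asIdeal ∧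
      (∀ w, (W.baseChange K).kummerSelmerStructure ((p ^ k : ℕ) : ℤ) w ≤
        (W.baseChange K).kummerSelmerStructure ((p ^ k : ℕ) : ℤ) w) ∧
      (∀ (v w : HeightOneSpectrum (𝓞 K)) (h : τ • v = w), v ∈ ({v₀, τ • v₀} : Finset _) →
        ∀ x : galoisCohomology (((W.baseChange K).torsionGaloisModule ((p ^ k : ℕ) : ℤ)).toLocal
          (Sum.inr v : Place K)) 1,
        x ∈ (W.baseChange K).kummerSelmerStructure ((p ^ k : ℕ) : ℤ) (Sum.inr v) →
          conjActPlace W τ ((p ^ k : ℕ) : ℤ) h x ∈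
            (W.baseChange K).kummerSelmerStructure ((p ^ k : ℕ) : ℤ) (Sum.inr w)) ∧
      IsAddCyclic (↥((W.baseChange K).kummerSelmerStructure ((p ^ k : ℕ) : ℤ) (Sum.inr v₀)) ⧸
        ((W.baseChange K).kummerSelmerStructure ((p ^ k : ℕ) : ℤ) (Sum.inr v₀)).addSubgroupOf
          ((W.baseChange K).kummerSelmerStructure ((p ^ k : ℕ) : ℤ) (Sum.inr v₀))) ∧
      ((W.baseChange K).kummerSelmerStructure ((p ^ k : ℕ) : ℤ) (Sum.inr v₀)).relIndex
          ((W.baseChange K).kummerSelmerStructure ((p ^ k : ℕ) : ℤ) (Sum.inr v₀)) = p ^ 0 := by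
  obtain ⟨v₀, hv₀, hv₀N, -⟩ := exists_split_place_of_dvd K hK τ hτ hH q hqN
  have hv₀N' : ((W.conductorNorm ℤ : ℕ) : 𝓞 K) ∈ (τ • v₀).asIdeal := by
    have := (HeightOneSpectrum.smul_mem_smul_asIdeal_iff τ v₀ ((W.conductorNorm ℤ : ℕ) : 𝓞 K)).mpr hv₀N
    rwa [GlobalDuality.smul_natCast_ringOfIntegers] at this
  refine ⟨v₀, hv₀, hv₀N, hv₀N', fun _ ↦ le_rfl,
    fun v' w h _ x hx ↦ conjActPlace_mem_kummerSelmerStructure W τ _ h hx, ?_, ?_⟩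
  · refine ⟨⟨0, fun x ↦ ⟨0, ?_⟩⟩⟩
    induction x using QuotientAddGroup.induction_on with
    | H a =>
      change (0 : ℤ) • (0 : _ ⧸ _) = _
      rw [zero_zsmul, eq_comm, QuotientAddGroup.eq_zero_iff]
      exact AddSubgroup.mem_addSubgroupOf.mpr a.2
  · rw [AddSubgroup.relIndex_self, pow_zero]

end Summit.BirchSwinnertonDyer.Rank1Residual.JET.Walk

end
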